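import Literature.AlgebraicGeometry.Frobenioids.ArchimedeanTheoremsInstances
import Literature.AlgebraicGeometry.Frobenioids.ArchimedeanWeaklyDissectible
import Literature.AlgebraicGeometry.Frobenioids.ArchimedeanIndissectibleAngular
import HarnessLib

/-!
# Frobenioids II, Theorem 3.6 (viii) and (ix) at the categories of Example 3.3 — the instance
# statements `Thm36viii_CA`, `Thm36ix_CA` (proof-only companion)

Mochizuki, *The geometry of Frobenioids II: poly-Frobenioids*, Kyushu J. Math. **62** (2008) 401–460,
§3, Theorem 3.6 (viii), (ix), kurims p. 38 (proof p. 39) [cite: MochizukiFrdII2008, Thm 3.6 (viii)-(ix) p.38]: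

> (viii) If `Λ = ℤ`, then `F[ℂ]` is of weakly dissectible type [cf. §0].
> (ix) Suppose that `D` is of strongly indissectible type [cf. §0]. If `D` is not complexifiable, then we
> assume further that `Λ ≠ ℤ`. Then `F^istr` is of strongly indissectible type.

PROOF-ONLY companion (abc-iut cell, layer L1, DAG nodes `FrdII:Thm3.6(viii)`, `FrdII:Thm3.6(ix)`;
L1-lead R68 (C) MENU M6, seat abc-iut-w4-d027) of the INSTANCE statements of abc-iut-L1-t9's
`ArchimedeanTheoremsInstances.lean` — `ArchFrd.Thm36viii_CA π pf rlf` and `ArchFrd.Thm36ix_CA π pf rlf`,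
i.e. the generic schemas `ArchFrd.Thm36viii` / `ArchFrd.Thm36ix` of `ArchimedeanBasicProperties.lean`
evaluated at `F := (ArchFrd.archFrobenioid π pf rlf Λ).str` for every monoid type `Λ` and at the angular
Frobenioid `F := ArchFrd.A.toElem π` — assembled from the landed per-category theorems of seat
abc-iut-L1-t6 (`ArchFrd.thm36viii_C`, `ArchFrd.thm36viii_A`, `ArchimedeanWeaklyDissectible.lean`;
`ArchFrd.Indissect.thm36ix_C`, `ArchFrd.Indissect.thm36ix_A`, `ArchimedeanIndissectibleAngular.lean`).
Nothing is re-typed; no statement of the paper is strengthened.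

* **(viii) — DISCHARGED IN FULL** (`thm36viii_CA_holds`). The schema `Thm36viii G F Λ` reads
  `Λ = ℤ → F[ℂ] weakly dissectible`; at `Λ = ℤ` the archimedean Frobenioid `C^ℤ` IS `C`
  (`ArchFrd.archFrobenioid_Z`, definitional), where the statement is `thm36viii_C`; at `Λ ∈ {ℚ, ℝ}`
  the schema's own hypothesis `Λ = ℤ` is absurd, so those conjuncts hold vacuously (exactly as print:
  (viii) says nothing about `C^ℚ`, `C^ℝ`); the `A`-conjunct is `thm36viii_A`.
* **(ix) — the `Λ = ℤ` and `A` conjuncts DISCHARGED** (`thm36ix_CA_Z`, `thm36ix_CA_A`, from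
  `Indissect.thm36ix_C` / `Indissect.thm36ix_A`, themselves unconditional over any base `π : D → D₀`);
  the full instance statement is reduced to EXACTLY its two `Λ ∈ {ℚ, ℝ}` conjuncts
  (`thm36ix_CA_iff`, `thm36ix_CA_of`). HONEST STATUS of those two conjuncts (finding T36ix-F1, the
  (ix)-analogue of the layer's T36x-F1 on (x)): they speak about `(C^ℚ)^istr = (C^pf)^istr` and
  `(C^ℝ)^istr = (C^rlf)^istr`, which the tree types only through the UNINTERPRETED interface
  `ArchFrd.LambdaCompletion` (an arbitrary category with a pre-Frobenioid structure receiving a functor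
  from `C` over `D`; the perfection / realification of [FrdI] Def. 3.1 (iii) / Prop. 5.3 are not yet
  bound to it), so `Thm36ix (baseRC π) pf.str ℚ` is a statement about an arbitrary datum `pf`, not about a
  constructed category, and is not dischargeable as typed; it becomes dischargeable once `pf`, `rlf` are
  the constructed completions (TODO-merge abc-iut-L1-t3 / abc-iut-L1-t5, as recorded in
  `AngularFrobenioidsRelative.lean`). No new `Prop` is introduced here; the residual is named by the
  existing schema at the existing interface.

Classical; takes no side on anything disputed; nothing here bears on [IUTchIII] Cor. 3.12.
-/

namespace Literature.AlgebraicGeometry.Frobenioids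

open CategoryTheory

universe v u

namespace ArchFrd

variable {D : Type u} [Category.{v} D] (π : D ⥤ D0) (pf rlf : LambdaCompletion π)

/-! ### Theorem 3.6 (viii) -/

/-- **Thm. 3.6 (viii) for `C^Λ`, every `Λ`** ([FrdII] p. 38): at `Λ = ℤ` this is `thm36viii_C` (`C^ℤ = C`,
`archFrobenioid_Z`); at `Λ ∈ {ℚ, ℝ}` the schema's hypothesis `Λ = ℤ` is absurd.
[cite: MochizukiFrdII2008, Thm 3.6 (viii) p.38] -/
theorem thm36viii_archFrobenioid (Λ : MonoidType) :
    Thm36viii (baseRC π) (archFrobenioid π pf rlf Λ).str Λ := by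
  cases Λ with
  | Z => exact thm36viii_C π
  | Q => intro h; exact absurd h (by decide)
  | R => intro h; exact absurd h (by decide)

/-- **Thm. 3.6 (viii) for `C^Λ` and `A` — the instance statement `Thm36viii_CA` DISCHARGED** (DAG node
`FrdII:Thm3.6(viii)`): "If `Λ = ℤ`, then `F[ℂ]` is of weakly dissectible type", `F ∈ {C^Λ, A}`, over any
base `π : D → D₀` and any completion data `pf`, `rlf`. [cite: MochizukiFrdII2008, Thm 3.6 (viii) p.38] -/
theorem thm36viii_CA_holds :
    Literature.AlgebraicGeometry.Frobenioids.ArchFrd.Thm36viii_CA π pf rlf :=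
  ⟨thm36viii_archFrobenioid π pf rlf, thm36viii_A π⟩

/-- `Thm36viii_CA` — `_holds` alias of `thm36viii_CA_holds` above under the fact's exact name (appended
2026-08-28, D-0026 bookkeeping: the proof term is the existing theorem of this file; no statement,
definition or attribute is edited; no new named fact; the ledger's debt table listed the fact
unproved). [cite: MochizukiFrdII2008, Thm 3.6 (viii) p.38] -/
theorem _root_.Literature.AlgebraicGeometry.Frobenioids.ArchFrd.Thm36viii_CA_holds :
    Literature.AlgebraicGeometry.Frobenioids.ArchFrd.Thm36viii_CA π pf rlf :=
  _root_.Literature.AlgebraicGeometry.Frobenioids.ArchFrd.thm36viii_CA_holds (π := π) (pf := pf) (rlf := rlf)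

/-! ### Theorem 3.6 (ix) -/

/-- **Thm. 3.6 (ix) for `C^ℤ = C`** ([FrdII] p. 38), the `Λ = ℤ` conjunct of `Thm36ix_CA`: `D` of strongly
indissectible type (and complexifiable, as the printed proviso forces at `Λ = ℤ`) ⟹ `C^istr` of strongly
indissectible type — `Indissect.thm36ix_C` transported along `C^ℤ = C`.
[cite: MochizukiFrdII2008, Thm 3.6 (ix) p.38] -/
theorem thm36ix_CA_Z : Thm36ix (baseRC π) (archFrobenioid π pf rlf .Z).str .Z :=
  Indissect.thm36ix_C π

/-- **Thm. 3.6 (ix) for the angular Frobenioid `A`** ([FrdII] p. 38), the `A`-conjunct of `Thm36ix_CA`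
(`Indissect.thm36ix_A`). [cite: MochizukiFrdII2008, Thm 3.6 (ix) p.38] -/
theorem thm36ix_CA_A : Thm36ix (baseRC π) (A.toElem π) .Z :=
  Indissect.thm36ix_A π

/-- **Thm. 3.6 (ix), instance statement — what it reduces to.** `Thm36ix_CA π pf rlf` holds iff its two
`Λ ∈ {ℚ, ℝ}` conjuncts hold, i.e. the schema at the completion data `pf` (`C^ℚ := C^pf`) and `rlf`
(`C^ℝ := C^rlf`); the `Λ = ℤ` and `A` conjuncts are theorems (`thm36ix_CA_Z`, `thm36ix_CA_A`). The two
remaining conjuncts concern the interface `LambdaCompletion` (finding T36ix-F1, module docstring).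
[cite: MochizukiFrdII2008, Thm 3.6 (ix) p.38] -/
theorem thm36ix_CA_iff :
    Literature.AlgebraicGeometry.Frobenioids.ArchFrd.Thm36ix_CA π pf rlf ↔
      Thm36ix (baseRC π) pf.str .Q ∧ Thm36ix (baseRC π) rlf.str .R := by
  constructor
  · rintro ⟨h, -⟩
    exact ⟨h .Q, h .R⟩
  · rintro ⟨hQ, hR⟩
    refine ⟨fun Λ => ?_, thm36ix_CA_A π⟩
    cases Λ with
    | Z => exact thm36ix_CA_Z π pf rlf
    | Q => exact hQ
    | R => exact hR

/-- **Thm. 3.6 (ix) for `C^Λ` and `A` — the instance statement `Thm36ix_CA` from its `Λ ∈ {ℚ, ℝ}`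
conjuncts** (the perfection `C^pf` and realification `C^rlf` cases, which the tree types over the
interface `LambdaCompletion`; see T36ix-F1 in the module docstring). [cite: MochizukiFrdII2008, Thm 3.6 (ix) p.38] -/
theorem thm36ix_CA_of (hQ : Thm36ix (baseRC π) pf.str .Q) (hR : Thm36ix (baseRC π) rlf.str .R) :
    Literature.AlgebraicGeometry.Frobenioids.ArchFrd.Thm36ix_CA π pf rlf :=
  (thm36ix_CA_iff π pf rlf).2 ⟨hQ, hR⟩

end ArchFrd

end Literature.AlgebraicGeometry.Frobenioids
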